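import Mathlib
import Summits.Ventures.HodgeRepro2.Tier7.Target
import Summits.Ventures.HodgeRepro2.Tier7.Common.Datum
import Summits.Ventures.HodgeRepro2.Tier7.Line1.Defs

/-!
# Tier7/Line1/WedgeNonzero — L1.1 / L1.1′ in hypothesis-carrying form (t7-L1-p4)

Cell pub-hodge-repro2, Tier 7 (README §11–§12), LINE L1 (Hecke-module rigidity, t7-plan-1), prover t7-L1-p4.
Assignment (plan-1 LEMMAS.md §3 p4, lead l. 14639, plan-1 l. 14688): the two wedge lemmas of the line in their
HYPOTHESIS-CARRYING form — the universal `prodModS_ne_bot` was refuted by the datum of record (crit-1 l. 14626 O1) and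
is WITHDRAWN. Sorry-free; imports: Mathlib, `Tier7.Target`, `Tier7.Common.Datum` (typer: `fOmegaS_mem`, `Concl`),
`Tier7.Line1.Defs` (plan-1: `prodModS`, `prodModSbar`, `exists_irred_le_prodModS`). The pencil reading of the input
(Castelnuovo–de Franchis over the shadow) is the companion module `Tier7/Line1/WedgePencil.lean`.

THE DISPLAYED INPUT `WedgeNonzero` (L1.1) and `WedgeNonzeroBar` (L1.1′):
`WedgeNonzero D := ∃ g, f^*Ω_s(g) ≠ 0` («the wedge `θ(μ_0) ∧ θ(μ_1)` is a non-zero class for some Hecke translate»).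
Kernel record: `prodModS_ne_bot_iff : P_A ≠ ⊥ ↔ WedgeNonzero D` (L1.1 IS this input, by linear algebra), and
`wedgeNonzero_of_conclusion : (P)-for-`D` → WedgeNonzero D ∧ WedgeNonzeroBar D` — so L1.1/L1.1′ are IMPLIED BY THE
CONCLUSION and are NOT residuals of the deliverable (lead l. 14639: «a displayed INPUT, never a residual»); they feed
only `exists_irred_le_prodModS(bar)_of_wedge` ((H9)). Two-sided test, for the record: the input FAILS in every datum
with `H10 * H10 = ⊥` (`not_wedgeNonzero_of_mul_eq_bot`, the square-zero datum of record).

§8(d): uses an L-value-free non-vanishing device: NO (no non-vanishing is claimed here; an input is named).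
-/

namespace Summit.Ventures.HodgeRepro2.Tier7.Line1

open Summit.Ventures.HodgeRepro2.Tier7

noncomputable section

variable {K : Type} [Field K] [NumberField K] {E' : Type} [Field E'] [NumberField E']
  {V : Type} [AddCommGroup V] [Module E' V] {HX : Type} [Ring HX] [Algebra ℂ HX]
  {G : Type} [Group G] [MulAction G HX]

/-! ## 1. The displayed input `WedgeNonzero` / `WedgeNonzeroBar` and what it gives -/

section Input

variable (D : PeriodDatum K E' V HX G)

/-- L1.1 as a displayed INPUT: «for some choice of the Hecke translates the wedge `f^*Ω_s = θ(μ_0) ∧ θ(μ_1)` is a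
non-zero class». A consequence of (P) (`wedgeNonzero_of_conclusion`), hence never a residual of the deliverable. -/
def WedgeNonzero : Prop := ∃ g : Fin 4 → G, D.fOmegaS g ≠ 0

/-- L1.1′ as a displayed INPUT: the same for `f^*Ω_{s̄} = θ(μ_2) ∧ θ(μ_3)`. -/
def WedgeNonzeroBar : Prop := ∃ g : Fin 4 → G, D.fOmegaSbar g ≠ 0

/-- (L1.1, hypothesis-carrying form) `P_A ≠ ⊥` from a non-zero wedge: the span of a set containing a non-zero
element is not `⊥`. -/
theorem prodModS_ne_bot_of_wedge (h : WedgeNonzero D) : prodModS D ≠ ⊥ := by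
  obtain ⟨g, hg⟩ := h
  intro hbot
  have hmem : D.fOmegaS g ∈ prodModS D := Submodule.subset_span ⟨g, rfl⟩
  rw [hbot, Submodule.mem_bot] at hmem
  exact hg hmem

/-- (L1.1′, hypothesis-carrying form) `P_B ≠ ⊥` from a non-zero wedge of the corners `2, 3`. -/
theorem prodModSbar_ne_bot_of_wedge (h : WedgeNonzeroBar D) : prodModSbar D ≠ ⊥ := by
  obtain ⟨g, hg⟩ := h
  intro hbot
  have hmem : D.fOmegaSbar g ∈ prodModSbar D := Submodule.subset_span ⟨g, rfl⟩
  rw [hbot, Submodule.mem_bot] at hmem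
  exact hg hmem

/-- Conversely `P_A ≠ ⊥` forces a non-zero generator: the span of a set of zeros is `⊥`. -/
theorem wedgeNonzero_of_ne_bot (h : prodModS D ≠ ⊥) : WedgeNonzero D := by
  by_contra hcon
  apply h
  apply Submodule.span_eq_bot.mpr
  rintro _ ⟨g, rfl⟩
  by_contra hne
  exact hcon ⟨g, hne⟩

/-- Conversely `P_B ≠ ⊥` forces a non-zero generator. -/
theorem wedgeNonzeroBar_of_ne_bot (h : prodModSbar D ≠ ⊥) : WedgeNonzeroBar D := by
  by_contra hcon
  apply h
  apply Submodule.span_eq_bot.mpr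
  rintro _ ⟨g, rfl⟩
  by_contra hne
  exact hcon ⟨g, hne⟩

/-- L1.1 IS the input `WedgeNonzero` (linear algebra, both ways). -/
theorem prodModS_ne_bot_iff : prodModS D ≠ ⊥ ↔ WedgeNonzero D :=
  ⟨wedgeNonzero_of_ne_bot D, prodModS_ne_bot_of_wedge D⟩

/-- L1.1′ IS the input `WedgeNonzeroBar`. -/
theorem prodModSbar_ne_bot_iff : prodModSbar D ≠ ⊥ ↔ WedgeNonzeroBar D :=
  ⟨wedgeNonzeroBar_of_ne_bot D, prodModSbar_ne_bot_of_wedge D⟩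

/-- THE INPUT IS IMPLIED BY THE CONCLUSION: a non-zero pairing `⟨f^*Ω_s, f^*Ω_{s̄}⟩_{L²} ≠ 0` has both wedges
non-zero (`L2 0 b = 0 = L2 a 0`). Hence L1.1 / L1.1′ are not residuals of the deliverable. -/
theorem wedgeNonzero_of_conclusion (h : ∃ g : Fin 4 → G, D.S.L2 (D.fOmegaS g) (D.fOmegaSbar g) ≠ 0) :
    WedgeNonzero D ∧ WedgeNonzeroBar D := by
  obtain ⟨g, hg⟩ := h
  refine ⟨⟨g, ?_⟩, ⟨g, ?_⟩⟩
  · intro h0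
    apply hg
    rw [h0]
    exact D.S.L2_zero_left _
  · intro h0
    apply hg
    rw [h0]
    exact D.S.L2_zero_right _

/-- The same, phrased with the typer's `PeriodDatum.Concl`. -/
theorem wedgeNonzero_of_concl (h : D.Concl) : WedgeNonzero D ∧ WedgeNonzeroBar D :=
  wedgeNonzero_of_conclusion D h

/-- (from (H9)) under the input, `P_A` contains a Hecke-irreducible constituent. -/
theorem exists_irred_le_prodModS_of_wedge (h : WedgeNonzero D) :
    ∃ W : Submodule ℂ HX, W ≤ prodModS D ∧ HeckeIrred G W :=
  exists_irred_le_prodModS D (prodModS_ne_bot_of_wedge D h)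

/-- (from (H9)) under the input, `P_B` contains a Hecke-irreducible constituent. -/
theorem exists_irred_le_prodModSbar_of_wedge (h : WedgeNonzeroBar D) :
    ∃ W : Submodule ℂ HX, W ≤ prodModSbar D ∧ HeckeIrred G W :=
  exists_irred_le_prodModSbar D (prodModSbar_ne_bot_of_wedge D h)

/-- Two-sided record: the input FAILS in every datum with `H10 * H10 = ⊥` (the square-zero datum of record): every
wedge lies in `H10 * H10`. -/
theorem not_wedgeNonzero_of_mul_eq_bot (hbot : D.S.H10 * D.S.H10 = ⊥) : ¬ WedgeNonzero D := by
  rintro ⟨g, hg⟩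
  apply hg
  have hmem := D.fOmegaS_mem g
  rw [hbot, Submodule.mem_bot] at hmem
  exact hmem

/-- The same for the corners `2, 3`. -/
theorem not_wedgeNonzeroBar_of_mul_eq_bot (hbot : D.S.H10 * D.S.H10 = ⊥) : ¬ WedgeNonzeroBar D := by
  rintro ⟨g, hg⟩
  apply hg
  have hmem := D.fOmegaSbar_mem g
  rw [hbot, Submodule.mem_bot] at hmem
  exact hmem

end Input

end

end Summit.Ventures.HodgeRepro2.Tier7.Line1
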